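/-
Origin: expansion seat `planner-pub-hodgecm-mc-theta-3-g8-0`, handover #2 16:41Z md5 610c249f74a5 (114 l.; NEW additive PKG Model leaf, ns HodgeCM.Model.ArchKTypeData; imports `HodgeCM.Model.ArchKTypeJunction` (row #1) + twin `HodgeCM.Vendored.H21.RepresentationTheory.KonnoKonno2007.JunctionFactorisationExpP` (#K290). 2 theorems, 0 defs / 0 records / 0 `def … : Prop` / 0 cited binders, MODEL-N ±0: § 2′ `ArchKTypeData.isWeaklyPDiff_of_isBlockPair` / `ArchKTypeData.isPMinusKilledAlong_of_isBlockPair` = E binders `hd : C.IsWeaklyPDiff expP` / `hk : ∀ p, C.IsPMinusKilledAlong expP (-I • e_p)` from a BLOCK PAIR `h : IsBlockPair ιP ω ιP₁ ω₁ s` (Weil1964/ArchWeilDatumFactorisation :156) + the small datum `hW₁` (+ `hvac₁`) + frame `e` + intertwiner `τ`/`hτ` + `Φ₂`/`Φ₁`/`hΦ` (+ `hf`), character-free along the 𝔭-chart (χc := 1 via `IsBlockPair.apply_sumProdLeft_expP_clm_inl` + #K290 `map_expP_eq_one`), calling row #1 § 1. EVIDENCE 16:38–16:40Z: private per-module `lean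 -o` in mirror `mc/pub-hodgecm-mc-theta-3-g8/work/recutmirror/olean` (= RUN-35 PKG oleans + re-cut pair b5dc23ddeec9 + its 30 rebuilt dependents + #K290 twin 1facb2cc2444 built from glue-2's stage + row #1 df75ee09e750): rc 0 / 0 warnings; `#print axioms` both = {propext, Classical.choice, Quot.sound} (`work/ax-ArchKTypeJunctionExpP-r36world.txt`); row #1 rebuilt in the same mirror rc 0 / 0 warnings (17 s).) (`HOME/mc/pub-hodgecm-mc-theta-3-g8/lean/stage/HodgeCM/Model/ArchKTypeJunctionExpP.lean`, md5 610c249f, 114 lines);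
landed by the gen-12 packager (p-g12) in gate run 36 as `HodgeCM/Model/ArchKTypeJunctionExpP.lean` (verbatim).
-/
/-
Origin: construction seat `planner-pub-hodgecm-mc-theta-3-g8-0` (pub-hodgecm MODEL-CONSTRUCTION sub-cell, theta lane, BRICK 4 § 2′),
STAGED 2026-08-19 16:4xZ as row #2 of `mc/pub-hodgecm-mc-theta-3-g8/t36-mctheta3g8.txt` (NEW additive PKG Model leaf).  Install order:
AFTER the K-1 v20 twin #K290 `HodgeCM.Vendored.H21.RepresentationTheory.KonnoKonno2007.JunctionFactorisationExpP` (vendored copy of the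
tree file `Literature/RepresentationTheory/KonnoKonno2007/JunctionFactorisationExpP.lean`, p187381 ACCEPTED) and AFTER row #1
`HodgeCM/Model/ArchKTypeJunction.lean`.  Evidence: private per-module `lean -o` against the RUN-35 PKG oleans + the re-cut pair
b5dc23ddeec9 + its rebuilt dependents + the staged #K290 twin 1facb2cc2444: rc 0 / 0 warnings, axioms {propext, Classical.choice, Quot.sound} (see STATUS).
-/
import Summits.HodgeConjecture.HodgeCM.Model.ArchKTypeJunction
import Literature.RepresentationTheory.KonnoKonno2007.JunctionFactorisationExpP

/-!
# BRICK 4 § 2′ — E's `hd` / `hk` from a BLOCK PAIR (character-free along the `𝔭`-chart)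

Model item (T-j), theta-3.  `Model/ArchKTypeJunction` § 2 derives the END-STATE binders
`hd : C.IsWeaklyPDiff expP` and `hk : ∀ p, C.IsPMinusKilledAlong expP (-I • e_p)` from a FULL archimedean Weil datum
`hW : IsArchWeilDatum ι𝕎' ω` of the big group (used only to manufacture the continuous circle character of the
factorisation).  By the theta-2-g14 finding (K-1 twin `KonnoKonno2007/JunctionFactorisationExpP`: every homomorphism
`U(2,1) →* M` into a commutative monoid is trivial on `exp 𝔭`, `map_expP_eq_one`), the factor character is invisible
along the chart, so the same binders follow from the big family at **`IsBlockPair` strength only**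
(`Weil1964/ArchWeilDatumFactorisation` :156 — Heisenberg covariance (w2) + operator continuity of both families +
the block identity along `s`), calling § 1 with `χc := 1` through `IsBlockPair.apply_sumProdLeft_expP_clm_inl`.
Consequently (w1) orbit continuity, (w2′) unitary `L²` lifts, continuity of `s` and the circle character of the BIG
datum are NOT on BRICK 4's critical path; residual (a) = frame pin + `block` + `τ`/`hτ` (binder-2's `HypCensus/ArchDatum`).

KERNEL MATHEMATICS ONLY: two theorems, no definition, no record, no cited hypothesis.

References: G. B. Folland, *Harmonic Analysis in Phase Space* (1989), §4.2; K. Konno, *Tokyo J. Math.*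
25 (2002) §3; A. Weil, Acta Math. 111 (1964) n° 37.
-/

noncomputable section

open Filter Topology Complex
open scoped Classical SchwartzMap
open MulAction NumberField.mixedEmbedding
open Literature.NumberTheory.Automorphic Literature.NumberTheory.Weil1964 Literature.Analysis.SegalBargmann
open Literature.AlgebraicGeometry.HodgeTheory
open Literature.AlgebraicGeometry.ShimuraVarieties Literature.AlgebraicGeometry.ShimuraVarieties.BallForms
open Literature.Geometry.ComplexHyperbolic.BallModel
open Literature.RepresentationTheory.KonnoKonno2007 Literature.RepresentationTheory.KonnoKonno2007.RealDualPair
open Literature.NumberTheory.Automorphic.PicardCM Literature.Analysis.Distribution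
open Literature.RepresentationTheory.HeisenbergGroup
open HodgeCM.PerL34.Seesaw HodgeCM.PerL34.RationalCoset HodgeCM.PerL34.SupplyAdelic
open HodgeCM.Model.SupplyInstance HodgeCM.Model.SupplyResidual
open HodgeCM.Model.ThetaSpace

namespace HodgeCM
namespace Model

section ArchJunctionExpP

variable {U : Universe} {Lc : CMField} {ι₁ : Lc →+* ℂ} {V : HermSpace3 Lc ι₁} {c : SeesawCtx Lc}

namespace ArchKTypeData

variable {X : ThetaSpaceInput U V c} {k : Fin 4} {N : ℕ} (B : ArchKTypeData X k N)
variable {R S : Type} [Fintype R] [DecidableEq R] [Fintype S] [DecidableEq S]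

set_option backward.isDefEq.respectTransparency false in
/-- **(AN) from a block pair**: the big family `ω` of `G` on `𝓢(ℝ^{DPIdx ⊕ σ₂})` and the junction datum `ω₁` of
`U(2,1) × U(R,S)` form an `IsBlockPair` along `s`, `τ` intertwines `ω ∘ s` with `B.ωinf` along the chart, and
`Φarch ℓ = τ (Φ₁ ℓ ⊠ Φ₂)`. -/
theorem isWeaklyPDiff_of_isBlockPair {σ₂ : Type} [Fintype σ₂] [DecidableEq σ₂] {G : Type} [Group G]
    {ιP : G → PhaseMap (DPIdx (Fin 2) Unit R S ⊕ σ₂)}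
    {ω : Representation ℂ G (SchwartzMap (DPIdx (Fin 2) Unit R S ⊕ σ₂ → ℝ) ℂ)}
    {ιP₁ : Ginf (Fin 2) Unit R S → PhaseMap (DPIdx (Fin 2) Unit R S)}
    {ω₁ : Representation ℂ (Ginf (Fin 2) Unit R S) (SchwartzMap (DPIdx (Fin 2) Unit R S → ℝ) ℂ)}
    {s : Ginf (Fin 2) Unit R S →* G} (h : IsBlockPair ιP ω ιP₁ ω₁ s)
    (hW₁ : IsArchWeilDatum (ι𝕎 (Fin 2) Unit R S) ω₁) {ev : VacExponents}
    (hvac₁ : ∀ kk : DPK (Fin 2) Unit R S, ω₁ (κ (Fin 2) Unit R S kk) (hermitePi 0) = vacScalar ev kk • hermitePi 0)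
    (e : (Fin 2 → ℂ) → X.G₁)
    (τ : SchwartzMap (DPIdx (Fin 2) Unit R S ⊕ σ₂ → ℝ) ℂ →L[ℂ] 𝓢((X.J → mixedSpace X.K), ℂ))
    (hτ : ∀ (b : Fin 2 → ℂ) (x : SchwartzMap (DPIdx (Fin 2) Unit R S ⊕ σ₂ → ℝ) ℂ), B.ωinf (e b) (τ x) =
      τ (ω (s (((u21FrameEquiv (expP b) : UForm (Fin 2) Unit), (1 : UForm R S)) : Ginf (Fin 2) Unit R S)) x))
    (Φ₂ : SchwartzMap (σ₂ → ℝ) ℂ) (Φ₁ : Module.Dual ℂ X.W → SchwartzMap (DPIdx (Fin 2) Unit R S → ℝ) ℂ)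
    (hΦ : ∀ ℓ, B.Φarch ℓ = τ (SchwartzMap.sumProdLeftCLM Φ₂ (Φ₁ ℓ))) :
    B.IsWeaklyPDiff e := by
  refine B.isWeaklyPDiff_of_junction hW₁ hvac₁ 1 continuous_const e (τ.comp (SchwartzMap.sumProdLeftCLM Φ₂)) Φ₁
    (fun ℓ => hΦ ℓ) (fun b ℓ => ?_)
  simpa [charTwist_apply] using
    h.apply_sumProdLeft_expP_clm_inl u21FrameEquiv τ (fun b => B.ωinf (e b)) id hτ Φ₂ b (Φ₁ ℓ)

set_option backward.isDefEq.respectTransparency false in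
/-- **(REP) along both `-i e_p` from a block pair**, given the harmonicity relations of the local vectors `Φ₁ ℓ`
(END-STATE shape `∀ p, C.IsPMinusKilledAlong e (-I • e_p)`). -/
theorem isPMinusKilledAlong_of_isBlockPair {σ₂ : Type} [Fintype σ₂] [DecidableEq σ₂] {G : Type} [Group G]
    {ιP : G → PhaseMap (DPIdx (Fin 2) Unit R S ⊕ σ₂)}
    {ω : Representation ℂ G (SchwartzMap (DPIdx (Fin 2) Unit R S ⊕ σ₂ → ℝ) ℂ)}
    {ιP₁ : Ginf (Fin 2) Unit R S → PhaseMap (DPIdx (Fin 2) Unit R S)}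
    {ω₁ : Representation ℂ (Ginf (Fin 2) Unit R S) (SchwartzMap (DPIdx (Fin 2) Unit R S → ℝ) ℂ)}
    {s : Ginf (Fin 2) Unit R S →* G} (h : IsBlockPair ιP ω ιP₁ ω₁ s)
    (hW₁ : IsArchWeilDatum (ι𝕎 (Fin 2) Unit R S) ω₁)
    (e : (Fin 2 → ℂ) → X.G₁)
    (τ : SchwartzMap (DPIdx (Fin 2) Unit R S ⊕ σ₂ → ℝ) ℂ →L[ℂ] 𝓢((X.J → mixedSpace X.K), ℂ))
    (hτ : ∀ (b : Fin 2 → ℂ) (x : SchwartzMap (DPIdx (Fin 2) Unit R S ⊕ σ₂ → ℝ) ℂ), B.ωinf (e b) (τ x) =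
      τ (ω (s (((u21FrameEquiv (expP b) : UForm (Fin 2) Unit), (1 : UForm R S)) : Ginf (Fin 2) Unit R S)) x))
    (Φ₂ : SchwartzMap (σ₂ → ℝ) ℂ) (Φ₁ : Module.Dual ℂ X.W → SchwartzMap (DPIdx (Fin 2) Unit R S → ℝ) ℂ)
    (hΦ : ∀ ℓ, B.Φarch ℓ = τ (SchwartzMap.sumProdLeftCLM Φ₂ (Φ₁ ℓ)))
    (hf : ∀ (p : Fin 2) ℓ, hypOpGen R S p () (Φ₁ ℓ) + I • rotBoostGen R S p () (Real.pi / 2) (Φ₁ ℓ) = 0) :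
    ∀ p : Fin 2, B.IsPMinusKilledAlong e (-Complex.I • (Pi.single p 1 : Fin 2 → ℂ)) := by
  refine B.isPMinusKilledAlong_of_junction' hW₁ 1 continuous_const e (τ.comp (SchwartzMap.sumProdLeftCLM Φ₂)) Φ₁
    (fun ℓ => hΦ ℓ) (fun b ℓ => ?_) hf
  simpa [charTwist_apply] using
    h.apply_sumProdLeft_expP_clm_inl u21FrameEquiv τ (fun b => B.ωinf (e b)) id hτ Φ₂ b (Φ₁ ℓ)

end ArchKTypeData

end ArchJunctionExpP

end Model
end HodgeCM

end
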